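import Literature.AnabelianGeometry.EtaleTheta.Discharge.Sec1Rmk164ZHatFormUnitsClosed
import Literature.AnabelianGeometry.EtaleTheta.ThetaSettingHatClass
import HarnessLib

/-!
# [EtTh] Remark 1.6.4 (c2) in `Ẑ`-form, EXACT, for the NAMED hat classes `hatClass` — displayed set {Prop15iii, ι_Ÿ completion}

S. Mochizuki, *The étale theta function …*, Publ. RIMS **45** (2009) [EtTh], Remark 1.6.4 (PRIMS pp. 252–253):
«the set of classes `O^×_K̈ · η̈^Θ ∈ H¹(Π^tp_Ÿ, Δ_Θ)` determines, by profinite completion, a set of classes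
`O^×_K̈ · (η̈^Θ)^∧ ∈ H¹(Π_{Ÿ^∧}, Δ_Θ)` on which any `Π_X/Π_{Y^∧} ≅ Ẑ ∋ a` acts via
`(η̈^Θ)^∧ ↦ (η̈^Θ)^∧ − 2a·log(Ü) − (a²/2)·log(q_X) + log(O^×_K̈)`» [cite: MochizukiEtTh2009, Rmk 1.6.4 pp.252-253].

abc-iut cell, prover abc-iut-f-142 (gen 9); rider «…_of_kummerUnits / hatClass» asked by abc-iut-L2-lead R1411 on the (α″) knit
(p520176).  PROOF-ONLY (no definition, no instance, no Prop-valued fact).  With abc-iut-w6-d081's NAMED assignment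
`HatTheta.hatClass hc : x′ ↦ x̂` (`ThetaSettingHatClass`; `hc : IsProfiniteCompletion T.ιYdd` the spec's one displayed input,
DISCHARGED at compact `(Π^tp_Ÿ)^Θ` by abc-iut-f-128's `isProfiniteCompletion_ιYdd_of_isCompact`) the four hat-class
characterisation binders of `rmk164_c2_zhat_of_prop15iii` are THEOREMS (`comap_hatClass`), so:
* `HatTheta.rmk164_c2_zhat_hatClass` — **(c2) in `Ẑ`-form, EXACT, for EVERY `σ̂ ∈ Π_X`**, for `x̂ := hatClass x′`,
  `L̂ := hatClass log(Ü)`, `Q̂ := hatClass kum(q̈)`, `Û(u) := hatClass kum(u)`: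
  `σ̂·infl(x̂) = infl(x̂) · infl(L̂)^(−2â) · infl(Q̂)^(−â²) · infl(Û(u))` for some `u ∈ O^×_K̈`, `â = toZHat σ̂` — displaying ONLY
  `Prop15iii`, `Compat` and `hc` (the `a ∈ ℤ` input is w6-d081's `hatClass_conj_formula`; the closedness clause is abc-iut-f-142's
  `hU_of_comap_eq`, p520176; the assembly is abc-iut-f-128's `rmk164_c2_zhat`, p517970);
* `HatTheta.rmk164_c2_zhat_hatClass_of_isCompact` — the same with `hc` discharged at compact `(Π^tp_Ÿ)^Θ`.
HONEST FRAMING: classical bookkeeping under OUR kernel check; `Prop15iii` is DISPLAYED (a hypothesis record over the frozen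
interface, inhabited at the cell's models); nothing here bears on [IUTchIII] Cor. 3.12; no side taken; typed ≠ proved.
-/

noncomputable section

namespace Literature.AnabelianGeometry.EtaleTheta

open scoped IsMulCommutative
open Literature.AnabelianGeometry.SemiGraphs

namespace ThetaSetting.HatTheta

variable {p : ℕ} [Fact p.Prime] {D : ThetaSetting p} (T : D.HatTheta)

/-- **[EtTh] Rmk 1.6.4 (c2) in `Ẑ`-form, EXACT, for the named hat classes** — for `x ∈ O^×_K̈·η̈^Θ` there is a Θ-class `x′`
with `infl x′ = x` such that for EVERY `σ̂ ∈ Π_X`, `â := toZHat σ̂`, some `u ∈ O^×_K̈` satisfies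
`σ̂·infl(hatClass x′) = infl(hatClass x′) · infl(hatClass log Ü)^(−2â) · infl(hatClass kum q̈)^(−â²) · infl(hatClass kum u)` in
`H¹(Π_{Ÿ^∧}, Δ_Θ)` («`(η̈^Θ)^∧ ↦ (η̈^Θ)^∧ − 2a·log(Ü) − (a²/2)·log(q_X) + log(O^×_K̈)`», `a ∈ Ẑ`).  Displayed: `Prop15iii`,
`Compat`, `hc : IsProfiniteCompletion ιYdd`. [cite: MochizukiEtTh2009, Rmk 1.6.4 pp.252-253] -/
theorem rmk164_c2_zhat_hatClass [T.DeltaThetaHat.Normal] (hc : IsProfiniteCompletion T.ιYdd) (hC : D.Compat)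
    (E : D.EtaleThetaData) (h15 : Prop15iii E hC) {x : D.H1 D.GtpYdd} (hx : x ∈ E.thetaClasses) :
    haveI := T.ghatThetaYdd_normal hC
    haveI := gtpYddHat_normal hC
    haveI := T.compactSpace_deltaThetaHat
    ∃ x' : D.H1Theta (D.GtpYdd.map D.toTheta), D.inflTheta D.GtpYdd x' = x ∧
      ∀ σh : D.PiHat, ∃ u ∈ D.unitsOKdd,
        ContH1.conj T.toThetaHat.toMonoidHom T.DeltaThetaHat σh (T.inflThetaHat (T.hatClass hc x')) =
          T.inflThetaHat (T.hatClass hc x')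
            * ContH1.zhatPow T.toThetaHat.toMonoidHom T.DeltaThetaHat D.GtpYddHat
                (D.toZHat σh * D.toZHat σh)⁻¹ (T.inflThetaHat (T.hatClass hc E.logUdd))
            * ContH1.zhatPow T.toThetaHat.toMonoidHom T.DeltaThetaHat D.GtpYddHat
                (ProfiniteZHatPow.powZHat (D.toZHat σh) (D.toZHat σh))⁻¹
                (T.inflThetaHat (T.hatClass hc (E.kumYdd (E.toKddHat D.qddUnit))))
            * T.inflThetaHat (T.hatClass hc (E.kumYdd (E.toKddHat u))) := by
  haveI := T.ghatThetaYdd_normal hC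
  haveI := gtpYddHat_normal hC
  haveI := T.compactSpace_deltaThetaHat
  obtain ⟨x', hx'x, -, hσ⟩ := T.hatClass_conj_formula hc hC E h15 hx
  refine ⟨x', hx'x, fun σh => ?_⟩
  exact T.rmk164_c2_zhat (T.hatClass hc x') (T.hatClass hc E.logUdd)
    (T.hatClass hc (E.kumYdd (E.toKddHat D.qddUnit))) (fun u => T.hatClass hc (E.kumYdd (E.toKddHat u))) hσ
    (T.hU_of_comap_eq E _ (fun u _ => T.comap_hatClass hc _)) σh

/-- The same with the completion input DISCHARGED at compact `(Π^tp_Ÿ)^Θ` (abc-iut-f-128's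
`isProfiniteCompletion_ιYdd_of_isCompact`): displayed set {`Prop15iii`, `Compat`, compactness of `(Π^tp_Ÿ)^Θ`}.
[cite: MochizukiEtTh2009, Rmk 1.6.4 pp.252-253] -/
theorem rmk164_c2_zhat_hatClass_of_isCompact [T.DeltaThetaHat.Normal]
    (hK : IsCompact ((D.GtpYddTheta : Subgroup D.GtpTheta) : Set D.GtpTheta)) (hC : D.Compat)
    (E : D.EtaleThetaData) (h15 : Prop15iii E hC) {x : D.H1 D.GtpYdd} (hx : x ∈ E.thetaClasses) :
    haveI := T.ghatThetaYdd_normal hC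
    haveI := gtpYddHat_normal hC
    haveI := T.compactSpace_deltaThetaHat
    ∃ x' : D.H1Theta (D.GtpYdd.map D.toTheta), D.inflTheta D.GtpYdd x' = x ∧
      ∀ σh : D.PiHat, ∃ u ∈ D.unitsOKdd,
        ContH1.conj T.toThetaHat.toMonoidHom T.DeltaThetaHat σh
            (T.inflThetaHat (T.hatClass (T.isProfiniteCompletion_ιYdd_of_isCompact hK) x')) =
          T.inflThetaHat (T.hatClass (T.isProfiniteCompletion_ιYdd_of_isCompact hK) x')
            * ContH1.zhatPow T.toThetaHat.toMonoidHom T.DeltaThetaHat D.GtpYddHat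
                (D.toZHat σh * D.toZHat σh)⁻¹
                (T.inflThetaHat (T.hatClass (T.isProfiniteCompletion_ιYdd_of_isCompact hK) E.logUdd))
            * ContH1.zhatPow T.toThetaHat.toMonoidHom T.DeltaThetaHat D.GtpYddHat
                (ProfiniteZHatPow.powZHat (D.toZHat σh) (D.toZHat σh))⁻¹
                (T.inflThetaHat (T.hatClass (T.isProfiniteCompletion_ιYdd_of_isCompact hK)
                  (E.kumYdd (E.toKddHat D.qddUnit))))
            * T.inflThetaHat (T.hatClass (T.isProfiniteCompletion_ιYdd_of_isCompact hK)
                (E.kumYdd (E.toKddHat u))) :=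
  T.rmk164_c2_zhat_hatClass (T.isProfiniteCompletion_ιYdd_of_isCompact hK) hC E h15 hx

end ThetaSetting.HatTheta

end Literature.AnabelianGeometry.EtaleTheta

end
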